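import Summits.CriticalPhenomena.PercolationContinuityZ3.Theorems.Transplant.SkelPhiNegReachCorridor1
import Summits.CriticalPhenomena.PercolationContinuityZ3.Theorems.Transplant.SkelPhiNegReachRoomsB
import Summits.CriticalPhenomena.PercolationContinuityZ3.Theorems.Transplant.SkelPhiNegReachTargets
import Summits.CriticalPhenomena.PercolationContinuityZ3.Theorems.Transplant.SkelPhiNegReachDeepB
import Summits.CriticalPhenomena.PercolationContinuityZ3.Theorems.Transplant.SkelPhiNegReachExcessB
import Summits.CriticalPhenomena.PercolationContinuityZ3.Theorems.Transplant.SkelPhiNegRealisedG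
import Summits.CriticalPhenomena.PercolationContinuityZ3.Theorems.Transplant.SkelPhiParaVLocDChain
import Summits.CriticalPhenomena.PercolationContinuityZ3.Theorems.Transplant.SkelPhiConcReachRun
import Summits.CriticalPhenomena.PercolationContinuityZ3.Theorems.Transplant.SkelPhiParaKitsC
import Summits.CriticalPhenomena.PercolationContinuityZ3.Theorems.Transplant.SkelPhiParaKitsCBand
import HarnessLib

/-!
# N1 (the `{±1}` node), (C) column file (C-S7a), RULING B.15 (S1): THE BAND RECORD OF THE ONE-FRAME CORRIDOR AND THE HABITAT FACTS OF ONE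
# CORRIDOR STEP — the per-step groundwork for discharging the kit clauses `hkitsR₁` / `hkitsR₂` of `reachOblRHN_negSG₂b` (C-A7-b, p295916):
# (§1) the band record `bandN` (x-band `xPrmW` for a u-corridor, y′-band `yPrmX` for a v-corridor) with its admissibility lemmas, two lines of
# level-width arithmetic, and the level data of a window-chain record at a frame; (§2) **`Skelφ.habStep_negSG₂b`**: for a realised run of the twin
# scheme of record continuing along `du`, a planar schedule over the run frame `runX φ (cOf α y) n h 1` whose region `k` is a box with the rooms
# `−5r + 1 ≤ · ≤ 22r − 1` along / `|·| ≤ 2r − 1` across (one unit of margin), and the plain window at the ROOT of depth `R := (E − L′) + r₀`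
# (`r₀ + 3 ≤ L′ ≤ E₀`, `E = E(nQ α y)`): the plain level and the frame's step box lie in the habitat (weak-steps habitat lemma
# `mem_Q_union_HfullSpan₂`), the step box is a `q`-sub-box of the corridor window (`isSubbox_Wcor_hab`), the plain windows over the region / the
# next core lie in the step box / its target part, and far level vertices and inner neighbours of padded contacts lie in the target part through
# the rim — the D″ pattern `reachOblRH_of_stepI` (p5-g6) made generic in the schedule; (§3) `level_widthsB`: the level boxes are wide enough from
# `j ≥ T_off` on.

builds on p205010 (kernel theorem, internal audit signed; external expert review pending) — nothing in this file uses p205010; nothing here is a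
claim about the open node `SamePDropOfSkeletonNeg`.
Lane `prim-bschramm`, seat `prim-bschramm-p5` (gen 9; (C) lineage); helper file (`--supports stmt-CriticalPhenomena-4575`).
[cite: KozmaNitzan2024, §4 Lemma 10 Steps III–V (pp. 19–22), Lemma 12 (pp. 23–25), p. 30 (Step IV)] [cite: MartineauTassion2017, §4.3 Lemma 4.2]
-/

noncomputable section

open MeasureTheory

namespace Summit.CriticalPhenomena.PercolationContinuityZ3.Theorems

namespace Transplant

namespace Skelφ

open Literature.Probability.Percolation Literature.Probability.LatticeModels SimpleGraph GadgetSystem ProbeHistory HSiteScheme Contour KNCells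
open KNCells.KSchA KNLevels ChainPlanar ChainPara
open Literature.Probability.Percolation.GM
open Literature.Probability.Percolation.KozmaNitzan.Cells (oth sgOf sgOf_sign stepVec_apply_fst stepVec_apply_oth)
open Literature.Barriers.CriticalPhenomena (graphBall graphBall_finite mem_graphBall_self graphBall_mono)
open BoxProdZ2 (ConcRadiiG nQ nS Erad Frad Erad_mono Frad_succ Frad_le_Erad Erad_add_gap_le_Frad_succ add_mul_le_Erad)
open TwoAxis.Para (modulus)
open Skel (excess winGraph winGraphIn winGraphIn_le ReachOblAtHN ReachOblRHN l1_tgt_le_nQ isSubbox_Wcor_hab)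
open SkelI (tanOff)

open scoped Classical

variable {V : Type} [DecidableEq V] {G : SimpleGraph V} [G.LocallyFinite] {φ : V → Site 2}

/-! ## §1 The band of the corridor by axis -/

/-- **The band record of the corridor along `du`**: the signed x-band `xPrmW` for a u-corridor (`du.1 = 0`), the signed y′-band `yPrmX` (drift `v`)
for a v-corridor (`du.1 = 1`). [this work] -/
def bandN (n ℓ : ℕ) (h v : ℤ) (R' qx Nx qy Ny : ℕ) (du : MDir) : RunPrm :=
  if du.1 = 0 then xPrmW n ℓ h R' qx Nx else yPrmX n ℓ h v R' qy Ny

/-- The band record is admissible (`1 ≤ n`, `|v| ≤ n`, two layers). [folklore] -/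
theorem bandN_ok {n ℓ : ℕ} {h v : ℤ} (hn : 1 ≤ n) (hv : |v| ≤ n) (hlay : 2 * ((n + h.natAbs : ℕ) : ℤ) ≤ (n : ℤ) * ℓ + 1) (R' qx Nx qy Ny : ℕ)
    (du : MDir) : RunOK (bandN n ℓ h v R' qx Nx qy Ny du) := by
  unfold bandN; split_ifs
  · exact xPrmW_ok n ℓ h R' qx Nx
  · exact yPrmX_ok hn hv hlay R' qy Ny

/-- `eb = ea` for the band record. [folklore] -/
theorem bandN_eb (n ℓ : ℕ) (h v : ℤ) (R' qx Nx qy Ny : ℕ) (du : MDir) : (bandN n ℓ h v R' qx Nx qy Ny du).eb = (bandN n ℓ h v R' qx Nx qy Ny du).ea := by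
  unfold bandN; split_ifs
  · exact xPrmW_eb n ℓ h R' qx Nx
  · exact yPrmX_eb n ℓ h v R' qy Ny

/-- The band's along slack is `R'`. [folklore] -/
theorem bandN_ea (n ℓ : ℕ) (h v : ℤ) (R' qx Nx qy Ny : ℕ) (du : MDir) : (bandN n ℓ h v R' qx Nx qy Ny du).ea = R' := by
  unfold bandN; split_ifs <;> rfl

/-- Pure arithmetic of the level widths: shrinking the addend keeps the bound. [folklore] -/
theorem wide_monoB {x a b c : ℤ} (h : a ≤ b) (hx : x + b ≤ c) : x + a ≤ c := by linarith

/-- Pure arithmetic of the level widths: `a ≤ b`, `t ≤ j` give `a - j + 2t ≤ b + j`. [folklore] -/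
theorem wide_auxB {a b t jz : ℤ} (hab : a ≤ b) (hj : t ≤ jz) : a - jz + 2 * t ≤ b + jz := by linarith

/-- The level data of a window-chain record at a frame whose corners at `k` are `lo', hi'`. [folklore] -/
theorem stepLF_eq_winLDataIn {ψ : V → Site 2} (hlip : Lip G ψ) (Ω : Finset V) (Pd : WinChainData V) (S : SchedFrame) (k : ℕ) {lo' hi' : Site 2}
    (hlo : S.lo k = lo') (hhi : S.hi k = hi') : Pd.stepLF (planarWindowIn hlip Ω) S k = winLDataIn G ψ Ω lo' hi' Pd.o Pd.Sfin := by
  subst hlo; subst hhi; rfl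

/-! ## §2 The habitat facts of one corridor step -/

/-- **The habitat facts of one corridor step of the twin scheme of record.** For a realised run `(ω, m, e)` continuing along `du`, a planar
schedule `Sc` over the run frame `runX φ (cOf α y) n h 1` whose region `k` is the box `[lo, hi]` with the rooms `−5r + 1 ≤ · ≤ 22r − 1` along /
`|·| ≤ 2r − 1` across (readings, one unit of margin), a level `j ≤ Sc.R'`, and the plain window at the root of depth `R := (E − L′) + r₀`
(`r₀ + 3 ≤ L′ ≤ E₀`, `1 ≤ r₀`): the plain level over `[lo k, hi k]` and the frame's step box lie in the habitat `Ω`; the step box is a `q`-sub-box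
of the corridor window; the plain level / the plain windows over the region and over the next core lie in the step box / its target part; far
level vertices and the inner neighbours of padded contacts lie in the target part through the rim (`hcover`). [cite: KozmaNitzan2024, §4 Lemma 10
Steps III–V (pp. 19–22), Lemma 12 (pp. 23–25)] -/
theorem habStep_negSG₂b [Countable V] (hlipφ : Lip G φ) {t : V} {A : ℤ} (hA : 0 < A) {n : ℕ} (hn : 1 ≤ n)
    {h vα vβ : ℤ} (hm : 0 < modulus n h vα vβ) {c₀' c₁' s₀ s₁ D : ℤ} (hc₀' : 0 < c₀') (hc₁' : 0 < c₁') (hD : 0 < D)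
    (F : V → Site 2) (hFdef : F = fineSkel φ t A n h vα vβ c₀' c₁' s₀ s₁ D) (hlipF : Lip G F) (hws : WeakSteps G F) (hF0 : F t = 0)
    (P : PCells2) (gap gap' : ℕ → ℕ) (E₀ L' : ℕ) (off : Site 2 → ℕ) (q : unitInterval) (δc : ℝ) (b₀ : Fin 2 → ℕ) (hb : ∀ i, b₀ i ≤ 3 * P.r i)
    (hΛ : WFS2 P (concRadii2N P gap gap' E₀ L' off)) (hgap : ∀ m, 20 * P.rmax ≤ gap m) {c : ℕ} (hgapc : ∀ m, c ≤ gap m)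
    (hoff : ∀ x : Site 2, off x ≤ c * ((x 0).natAbs + (x 1).natAbs) + 1) (hE₀ : 3 ≤ E₀)
    (cOf : ℕ → Site 2 → V) (hcF : ∀ a y, F (cOf a y) = P.cen y) {r₀ : ℕ} (hr₀L : r₀ + 3 ≤ L') (hL'E : L' ≤ E₀) (hr₀1 : 1 ≤ r₀) :
    let Λ := concRadii2N P gap gap' E₀ L' off
    let S : KSchA V ℕ := ⟨cellGeomSG₂b G F P t Λ b₀, q, δc⟩
    let FD := faceDataSG G F P t Λ
    ∀ (ω : BondConfig V) (m : ℕ) (e : Site 2 × MDir),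
      (S.astOf₂ G (S.hst₂ G ω m)).st.choice = some e → S.Valid₂ G (S.hst₂ G ω m) e → ∀ du ∈ S.onward G (S.hst₂ G ω m) (tgt e),
      ∀ (α β : ℕ) (y : Site 2), α = S.aOf₁ G (S.hst₂ G ω m) e → β = S.aOf₂ G (S.hst₂ G ω m) e → y = tgt e →
      let Ω := S.Γ.Ewv α e.1 e.2 ∪ FD.Hfull β y du
      let hlipR : Lip G (runX φ (cOf α y) n h 1) := lip_runX hlipφ (Or.inl rfl) hn (cOf α y) h
      let Rw := Erad gap gap' E₀ (nQ α y) - L' + r₀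
      ∀ (lo hi : Site 2),
      (sgOf du = 1 → -(5 * (P.r du.1 : ℤ)) + 1 ≤ rdLo A n h vα vβ c₀' c₁' D lo hi du.1 ∧ rdHi A n h vα vβ c₀' c₁' D lo hi du.1 ≤ 22 * (P.r du.1 : ℤ) - 1) →
      (sgOf du = -1 → -(5 * (P.r du.1 : ℤ)) + 1 ≤ -rdHi A n h vα vβ c₀' c₁' D lo hi du.1 ∧ -rdLo A n h vα vβ c₀' c₁' D lo hi du.1 ≤ 22 * (P.r du.1 : ℤ) - 1) →
      (-(2 * (P.r (oth du.1) : ℤ)) + 1 ≤ rdLo A n h vα vβ c₀' c₁' D lo hi (oth du.1) ∧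
        rdHi A n h vα vβ c₀' c₁' D lo hi (oth du.1) ≤ 2 * (P.r (oth du.1) : ℤ) - 1) →
      ∀ (Sc : ScheduleN) (k : ℕ), k ≤ Sc.N → Sc.region k = Finset.Icc lo hi → ∀ j ≤ Sc.R', ∀ Pd : WinChainData V,
      (∀ k', ∀ v ∈ (planarWindowIn hlipR Ω).stepDF Sc.toFrame k', v ∉ graphBall G t (Erad gap gap' E₀ (nQ α y) - L') → v ∈ Pd.Rim k') →
      winLevel G (runX φ (cOf α y) n h 1) t Rw (Sc.lo k) (Sc.hi k) j ⊆ Ω ∧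
      (planarWindowIn hlipR Ω).stepDF Sc.toFrame k ⊆ Ω ∧
      IsSubbox (winGraphIn G Ω) (S.Wcor G FD (S.hst₂ G ω m) e α β du) q ((planarWindowIn hlipR Ω).stepDF Sc.toFrame k) ∧
      winLevelIn (runX φ (cOf α y) n h 1) Ω (Sc.lo k) (Sc.hi k) j ⊆ (planarWindowIn hlipR Ω).stepDF Sc.toFrame k ∧
      Win G (runX φ (cOf α y) n h 1) t (Sc.region k) Rw ⊆ (planarWindowIn hlipR Ω).stepDF Sc.toFrame k ∧
      Win G (runX φ (cOf α y) n h 1) t (Sc.core (k + 1)) Rw ⊆ Pd.coreEF (planarWindowIn hlipR Ω) Sc.toFrame k ∧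
      (∀ v ∈ winLevel G (runX φ (cOf α y) n h 1) t Rw (Sc.lo k) (Sc.hi k) j, v ∉ graphBall G t (Rw - r₀) →
        v ∈ Pd.coreEF (planarWindowIn hlipR Ω) Sc.toFrame k) ∧
      (∀ x ∈ outerBoundary (winGraphIn G Ω) (winLevelIn (runX φ (cOf α y) n h 1) Ω (Sc.lo k) (Sc.hi k) j),
        x ∉ outerBoundary (winGraph G t Rw) (winLevel G (runX φ (cOf α y) n h 1) t Rw (Sc.lo k) (Sc.hi k) j) →
        inNbrIn G (runX φ (cOf α y) n h 1) Ω (Finset.Icc (Sc.lo k - (j : Site 2)) (Sc.hi k + (j : Site 2))) x ∈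
          Pd.coreEF (planarWindowIn hlipR Ω) Sc.toFrame k) := by
  intro Λ S FD ω m e hc hV du hdu α β y hα hβ hy
  subst hα hβ hy
  intro Ω hlipR Rw lo hi h1 h2 h3 Sc k hk hregI j hjR Pd hcover
  have hE₀1 : 1 ≤ E₀ := by omega
  -- the twin scheme's rules and the radii at the realised triple
  have hanch : ∀ a v Q, S.Γ.anchor a v Q = a + 1 := fun a v Q => by
    show (cellGeomSG₂b G F P t Λ b₀).anchor a v Q = a + 1
    rw [cellGeomSG₂b_anchor]; rfl
  have ha₀ : S.Γ.a₀ = 0 := cellGeomSG₂b_a₀ P t Λ b₀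
  have hroot0 : S.Γ.root ∈ S.Γ.col 0 := by
    show (cellGeomSG₂b G F P t Λ b₀).root ∈ (cellGeomSG₂b G F P t Λ b₀).col 0
    rw [cellGeomSG₂b_root, cellGeomSG₂b_col]
    show t ∈ {y : V | F y = P.cen 0}
    rw [Set.mem_setOf_eq, PCells2.cen_zero]; exact hF0
  obtain ⟨hEQ, hBE, hρ, -, -, -⟩ := reach_radii_concN hanch ha₀ hroot0 (P := P) (gap := gap) (gap' := gap') (E₀ := E₀) (L' := L') (off := off)
    hgap hgapc hoff hE₀1 hc hV hdu
  set α := S.aOf₁ G (S.hst₂ G ω m) e with hαdef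
  set β := S.aOf₂ G (S.hst₂ G ω m) e with hβdef
  set y := tgt e with hydef
  set E := Erad gap gap' E₀ (nQ α y) with hEdef
  have hEge : E₀ ≤ E := by
    have := add_mul_le_Erad gap' E₀ hgap (nQ α y)
    rw [← hEdef] at this; exact le_trans (Nat.le_add_right _ _) this
  -- the window depth
  have hRwdef : Rw = E - L' + r₀ := rfl
  have hRsub : Rw - r₀ = E - L' := by rw [hRwdef]; exact Nat.add_sub_cancel _ _
  have hR3 : Rw + 1 ≤ E - 2 := by omega
  -- the onward direction is not the way back
  have hdur : du ≠ rev e.2 := by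
    rintro rfl
    obtain ⟨y', hy', hyc⟩ := hV.src_mem
    have h1 := (Finset.mem_filter.1 hdu).2 y' hy'
    rw [show tgt e + stepVec (rev e.2) = e.1 from tgt_tgt_rev e] at h1
    exact h1 hyc
  -- the records of the twin, the old scheme's step record for the habitat lemma
  have hL := levelGeomSG₂b P t b₀ hΛ hlipF hb (Λ := Λ)
  have hQ : QSepGeom G S.Γ := qSepGeomSG₂b P t b₀ (Λ := Λ) hlipF
  have hSt := stepsGeomSG₂b P t b₀ hΛ hlipF hws hb (Λ := Λ)
  have hSt₀ := stepsGeomSG₂ P t hΛ hlipF hws (Λ := Λ)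
  have hΩold : Ω = (cellGeomSG₂ G F P t Λ).Ewv α e.1 e.2 ∪ FD.Hfull β y du := by
    show (cellGeomSG₂b G F P t Λ b₀).Ewv α e.1 e.2 ∪ FD.Hfull β y du = _
    rw [cellGeomSG₂b_Ewv]
  have hanchOld : β ∈ (cellGeomSG₂ G F P t Λ).anchSet α (tgt e) := by
    have h' := hV.anch
    change β ∈ (cellGeomSG₂b G F P t Λ b₀).anchSet α (tgt e) at h'
    rwa [cellGeomSG₂b_anchSet] at h'
  have hQE : ∀ v, v ∈ (cellGeomSG₂ G F P t Λ).Q α y ∪ (cellGeomSG₂ G F P t Λ).Efar β y du → v ∈ S.Γ.Q α y ∪ S.Γ.Efar β y du := by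
    intro v hv
    show v ∈ (cellGeomSG₂b G F P t Λ b₀).Q α y ∪ (cellGeomSG₂b G F P t Λ b₀).Efar β y du
    rw [cellGeomSG₂b_Q, cellGeomSG₂b_Efar]; exact hv
  set c₀ := cOf α y with hc₀def
  -- plain-window vertices read in the box `[lo, hi]` lie in the habitat and in the habitat proper (rooms with one unit of margin)
  have hWinΩ : ∀ v ∈ graphBall G t Rw, runX φ c₀ n h 1 v ∈ Finset.Icc lo hi → v ∈ Ω ∧ v ∈ S.Γ.Q α y ∪ S.Γ.Efar β y du := by
    intro v hvB hvR
    subst hFdef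
    have hpar := fine_sub_cen_mem_rd (s₀ := s₀) (s₁ := s₁) hA.le hn hm.le hc₀'.le hc₁'.le hD (hcF α y) hvR du.1
    have hperp := fine_sub_cen_mem_rd (s₀ := s₀) (s₁ := s₁) hA.le hn hm.le hc₀'.le hc₁'.le hD (hcF α y) hvR (oth du.1)
    have hl1 : -(5 * (P.r du.1 : ℤ)) + 1 ≤ P.lev du y (fineSkel φ t A n h vα vβ c₀' c₁' s₀ s₁ D v) := by
      rw [PCells2.lev_def]
      rcases sgOf_sign du with hs | hs <;> rw [hs]
      · have := (h1 hs).1; linarith only [this, hpar.1]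
      · have := (h2 hs).1; linarith only [this, hpar.2]
    have hl2 : P.lev du y (fineSkel φ t A n h vα vβ c₀' c₁' s₀ s₁ D v) ≤ 22 * (P.r du.1 : ℤ) - 1 := by
      rw [PCells2.lev_def]
      rcases sgOf_sign du with hs | hs <;> rw [hs]
      · have := (h1 hs).2; linarith only [this, hpar.2]
      · have := (h2 hs).2; linarith only [this, hpar.1]
    have hg := mem_Q_union_HfullSpan₂ (P := P) (Λ := Λ) (α := α) (a' := β) (y := y) (du := du) hlipF hws hvB (by rw [hEQ]; omega)
      (fun ℓ => by rw [hρ ℓ]; omega) hl1 hl2 (by linarith only [hperp.1, h3.1]) (by linarith only [hperp.2, h3.2])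
    have hvΩ : v ∈ Ω := by rw [hΩold]; exact Q_union_HfullSpan_subset_habΩ₂ hg
    refine ⟨hvΩ, hQE v (mem_Q_union_Efar_of_mem_habΩ₂ hSt₀ hanchOld hdur (by rw [hΩold] at hvΩ; exact hvΩ) ?_)⟩
    rcases Finset.mem_union.1 hg with hg | hg
    · exact Finset.mem_union_left _ (φ_mem_of_mem_VWin hg)
    · change v ∈ VStair G _ t (P.Hfull y du) (prof P Λ β y du) at hg
      exact Finset.mem_union_right _ (mem_of_mem_VStair hg).1
  -- the level box inside the region; the rooms of the region
  have hlev : Finset.Icc (Sc.lo k - ((j : ℕ) : Site 2)) (Sc.hi k + ((j : ℕ) : Site 2)) ⊆ Sc.region k := Sc.level_subset_region hk hjR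
  have hΩreg : ∀ v ∈ graphBall G t Rw, runX φ c₀ n h 1 v ∈ Sc.region k → v ∈ Ω ∧ v ∈ S.Γ.Q α y ∪ S.Γ.Efar β y du := fun v hvB hvR => by
    rw [hregI] at hvR
    exact hWinΩ v hvB hvR
  have hfull : winLevel G (runX φ c₀ n h 1) t Rw (Sc.lo k) (Sc.hi k) j ⊆ Ω := fun v hv => by
    obtain ⟨hvB, hvP⟩ := (mem_Win G _).1 hv
    exact (hΩreg v hvB (hlev hvP)).1
  have hPΩ : Win G (runX φ c₀ n h 1) t (Sc.region k) Rw ⊆ Ω := fun v hv => by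
    obtain ⟨hvB, hvP⟩ := (mem_Win G _).1 hv
    exact (hΩreg v hvB hvP).1
  have hDΩ : (planarWindowIn hlipR Ω).stepDF Sc.toFrame k ⊆ S.Γ.Ewv α e.1 e.2 ∪ FD.Hfull β y du := fun v hv =>
    ((mem_WinIn (φ := runX φ c₀ n h 1)).1 hv).1
  have hDh : (planarWindowIn hlipR Ω).stepDF Sc.toFrame k ⊆ S.Γ.Q α y ∪ S.Γ.Efar β y du := by
    intro v hv
    obtain ⟨hvΩ, hvR⟩ := (mem_WinIn (φ := runX φ c₀ n h 1)).1 hv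
    have hvR' : runX φ c₀ n h 1 v ∈ Finset.Icc lo hi := by rw [← hregI]; exact hvR
    subst hFdef
    have g1 : sgOf du = 1 → -(5 * (P.r du.1 : ℤ)) ≤ rdLo A n h vα vβ c₀' c₁' D lo hi du.1 ∧ rdHi A n h vα vβ c₀' c₁' D lo hi du.1 ≤ 22 * (P.r du.1 : ℤ) :=
      fun hs => ⟨by linarith only [(h1 hs).1], by linarith only [(h1 hs).2]⟩
    have g2 : sgOf du = -1 → -(5 * (P.r du.1 : ℤ)) ≤ -rdHi A n h vα vβ c₀' c₁' D lo hi du.1 ∧ -rdLo A n h vα vβ c₀' c₁' D lo hi du.1 ≤ 22 * (P.r du.1 : ℤ) :=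
      fun hs => ⟨by linarith only [(h2 hs).1], by linarith only [(h2 hs).2]⟩
    have g3 : -(2 * (P.r (oth du.1) : ℤ)) ≤ rdLo A n h vα vβ c₀' c₁' D lo hi (oth du.1) ∧
        rdHi A n h vα vβ c₀' c₁' D lo hi (oth du.1) ≤ 2 * (P.r (oth du.1) : ℤ) := ⟨by linarith only [h3.1], by linarith only [h3.2]⟩
    have hpl := room_Q_union_Hfull_of_rd (s₀ := s₀) (s₁ := s₁) (P := P) (y := y) (du := du) hA.le hn hm.le hc₀'.le hc₁'.le hD (hcF α y) g1 g2 g3 hvR'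
    exact hQE v (mem_Q_union_Efar_of_mem_habΩ₂ hSt₀ hanchOld hdur (by rw [hΩold] at hvΩ; exact hvΩ) hpl)
  have hsub : IsSubbox (winGraphIn G Ω) (S.Wcor G FD (S.hst₂ G ω m) e α β du) q ((planarWindowIn hlipR Ω).stepDF Sc.toFrame k) :=
    isSubbox_Wcor_hab hL hQ hSt hV hdu hV.anch hDΩ hDh
  have hDrΩ : (planarWindowIn hlipR Ω).stepDF Sc.toFrame k ⊆ Ω := hDΩ
  have hXD : winLevelIn (runX φ c₀ n h 1) Ω (Sc.lo k) (Sc.hi k) j ⊆ (planarWindowIn hlipR Ω).stepDF Sc.toFrame k :=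
    WinIn_mono _ subset_rfl hlev
  have hPD : Win G (runX φ c₀ n h 1) t (Sc.region k) Rw ⊆ (planarWindowIn hlipR Ω).stepDF Sc.toFrame k := fun v hv =>
    (mem_WinIn (φ := runX φ c₀ n h 1)).2 ⟨hPΩ hv, ((mem_Win G _).1 hv).2⟩
  have hPT : Win G (runX φ c₀ n h 1) t (Sc.core (k + 1)) Rw ⊆ Pd.coreEF (planarWindowIn hlipR Ω) Sc.toFrame k := fun v hv =>
    Finset.mem_union_left _ ((mem_WinIn (φ := runX φ c₀ n h 1)).2
      ⟨hPΩ (Win_mono G _ (Sc.succ k hk) le_rfl hv), ((mem_Win G _).1 hv).2⟩)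
  have hfarT : ∀ v ∈ winLevel G (runX φ c₀ n h 1) t Rw (Sc.lo k) (Sc.hi k) j, v ∉ graphBall G t (Rw - r₀) →
      v ∈ Pd.coreEF (planarWindowIn hlipR Ω) Sc.toFrame k := by
    intro v hv hfar
    have hD : v ∈ (planarWindowIn hlipR Ω).stepDF Sc.toFrame k := hXD ((mem_winLevelIn_iff _).2 ⟨hfull hv, ((mem_Win G _).1 hv).2⟩)
    rw [hRsub] at hfar
    exact Finset.mem_union_right _ (hcover k v hD hfar)
  have hpadT : ∀ x ∈ outerBoundary (winGraphIn G Ω) (winLevelIn (runX φ c₀ n h 1) Ω (Sc.lo k) (Sc.hi k) j),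
      x ∉ outerBoundary (winGraph G t Rw) (winLevel G (runX φ c₀ n h 1) t Rw (Sc.lo k) (Sc.hi k) j) →
      inNbrIn G (runX φ c₀ n h 1) Ω (Finset.Icc (Sc.lo k - (j : Site 2)) (Sc.hi k + (j : Site 2))) x ∈ Pd.coreEF (planarWindowIn hlipR Ω) Sc.toFrame k := by
    intro x hx hxn
    have hD : inNbrIn G (runX φ c₀ n h 1) Ω (Finset.Icc (Sc.lo k - (j : Site 2)) (Sc.hi k + (j : Site 2))) x ∈
        (planarWindowIn hlipR Ω).stepDF Sc.toFrame k := hXD (inNbrIn_mem_winLevelIn hx)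
    have hfar := inNbrIn_not_mem_graphBall hx hxn (d := E - L') (by omega)
    exact Finset.mem_union_right _ (hcover k _ hD hfar)
  exact ⟨hfull, hDrΩ, hsub, hXD, hPD, hPT, hfarT, hpadT⟩

/-! ## §3 The level widths -/

/-- **The level boxes are wide enough from `j ≥ T_off` on**: for a core `lo k ≤ hi k` enlarged by `j ≥ T_off` on both sides and a kit block
with `d + 2 ≤ D_sh`, `D_sh + KCmax + Rs ≤ T_off`: the three width margins `2·T_off`, `d + 2`, `D_sh + 1 + d + KCmax + Rs`. [folklore] -/
theorem level_widthsB (Sc : ScheduleN) {k : ℕ} (hk : k ≤ Sc.N + 1) (Pk : ApronPrm) {KCmax Rs j : ℕ} (hj0 : tanOff Pk.ℓs Pk.M ≤ j)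
    (hD1 : Pk.W + Pk.ℓ + Pk.d + 2 ≤ shellD Pk) (hT' : (shellD Pk : ℤ) + KCmax + Rs ≤ tanOff Pk.ℓs Pk.M) :
    (∀ i, (Sc.lo k - (j : Site 2)) i + 2 * tanOff Pk.ℓs Pk.M ≤ (Sc.hi k + (j : Site 2)) i) ∧
    (∀ i, (Sc.lo k - (j : Site 2)) i + (Pk.d + 2 : ℕ) ≤ (Sc.hi k + (j : Site 2)) i) ∧
    (∀ i, (Sc.lo k - (j : Site 2)) i + ((shellD Pk + 1 + Pk.d + KCmax + Rs : ℕ) : ℤ) ≤ (Sc.hi k + (j : Site 2)) i) := by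
  have hlohi : Sc.lo k ≤ Sc.hi k := Finset.nonempty_Icc.1 (Sc.nonempty k hk)
  have hsh : (shellD Pk : ℤ) ≤ tanOff Pk.ℓs Pk.M := by unfold tanOff shellD; push_cast; omega
  have hT₀ : (shellD Pk : ℤ) + 1 + Pk.d + KCmax + Rs ≤ 2 * tanOff Pk.ℓs Pk.M := by
    have h1 : ((Pk.d : ℕ) : ℤ) + 2 ≤ (shellD Pk : ℤ) := by exact_mod_cast (by omega : Pk.d + 2 ≤ shellD Pk)
    linarith only [h1, hT', hsh]
  have hd2 : ((Pk.d + 2 : ℕ) : ℤ) ≤ 2 * tanOff Pk.ℓs Pk.M := by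
    have h1 : ((Pk.d + 2 : ℕ) : ℤ) ≤ (shellD Pk : ℤ) := by exact_mod_cast (by omega : Pk.d + 2 ≤ shellD Pk)
    have h2 : (0 : ℤ) ≤ tanOff Pk.ℓs Pk.M := Nat.cast_nonneg _
    linarith only [h1, h2, hsh]
  have hwide : ∀ i, (Sc.lo k - (j : Site 2)) i + 2 * tanOff Pk.ℓs Pk.M ≤ (Sc.hi k + (j : Site 2)) i := fun i => by
    have hj0' : (tanOff Pk.ℓs Pk.M : ℤ) ≤ j := by exact_mod_cast hj0
    simp only [Pi.sub_apply, Pi.add_apply, Pi.natCast_apply]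
    exact wide_auxB (hlohi i) hj0'
  refine ⟨hwide, fun i => wide_monoB hd2 (hwide i), fun i => ?_⟩
  have h3 : (((shellD Pk + 1 + Pk.d + KCmax + Rs : ℕ) : ℤ)) = (shellD Pk : ℤ) + 1 + Pk.d + KCmax + Rs := by push_cast; ring
  rw [h3]; exact wide_monoB hT₀ (hwide i)

end Skelφ

end Transplant

end Summit.CriticalPhenomena.PercolationContinuityZ3.Theorems

end
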